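import Summits.KontsevichZagierPeriods.KontsevichZagierPeriods.Theorems.SymplecticScissorsRealOnePeriodRelationsStubEllPath
import Literature.NumberTheory.Transcendental.SemialgebraicRpow
import Mathlib.Analysis.SpecialFunctions.Pow.Deriv
import HarnessLib

/-!
# `BetaLinearSector` (stmt-KontsevichZagierPeriods-3897), line `fermat-sector-transport` — stub
# `stub_fermatSymbolData` (the symbol data on the affine Fermat curves)

For `N ≥ 1` the affine Fermat curve `F_N = {x^N + y^N = 1} ⊂ ℂ²` is a smooth affine curve over `ℚ̄`
in the sense of `CurvePeriods.CurveData.IsSmoothAffineCurve` (Huber–Wüstholz 2022, §3.3.1): its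
equation has algebraic coefficients, the gradient `(N x^{N−1}, N y^{N−1})` does not vanish on the
curve (if both entries vanish then `x^N = y^N = 0`, contradicting `x^N + y^N = 1`), and no point is
isolated (through `(x₀, y₀)` with `y₀ ≠ 0` passes the local branch
`u ↦ (x₀ + u, y₀ · exp(log(w(u))/N))`, `w(u) = (1 − (x₀+u)^N)/y₀^N`, `w(0) = 1`; if `y₀ = 0` then
`x₀ ≠ 0` and the roles are swapped).  The RADIAL ARC
`γ_N(t) = ((1−t)·Q(t)^{−1/N}, t·Q(t)^{−1/N})`, `Q(t) = (1−t)^N + t^N > 0` (all real `t`), is a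
`C¹` path on `F_N` (`((1−t)^N + t^N)·Q^{−1} = 1`) from `(1,0)` to `(0,1)`, and its realification is
a `ℚ`-semialgebraic map on `[0,1]` (the rational power `Q^{−1/N}` of a positive polynomial is
semialgebraic, `IsSemialgebraicFunOn.rpow_ratCast`).  Everything is folklore calculus and
Tarski–Seidenberg bookkeeping; templates `Weier.isSmoothAffineCurve`, `EllipticLayer.exists_path`.

References: B. Gross, *On the periods of abelian integrals and a formula of Chowla and Selberg*
(1978), §1 (with Rohrlich's appendix); A. Huber, G. Wüstholz, *Transcendence and Linear Relations of
1-Periods* (2022), §3.3.1; J. Bochnak, M. Coste, M.-F. Roy, *Real Algebraic Geometry* (1998), §2.2.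
-/

noncomputable section

open scoped BigOperators Topology
open Set MvPolynomial Filter
open Literature.NumberTheory.Transcendental Literature.NumberTheory.Transcendental.CurvePeriods
open Literature.ModelTheory.ExponentialFields (IsSemialgebraic)

namespace Summit.KontsevichZagierPeriods.FermatIsogeny.BetaLinearSector

/-! ## The affine Fermat curve `F_N = {x^N + y^N = 1}` -/

/-- `z ∈ F_N ↔ z₀^N + z₁^N = 1`. [cite: Gross1978, §1] -/
theorem mem_points_fermat_iff (N : ℕ) (z : Fin 2 → ℂ) :
    z ∈ (⟨2, 1, ![X 0 ^ N + X 1 ^ N - 1]⟩ : CurveData).points ↔ z 0 ^ N + z 1 ^ N = 1 := by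
  refine (CurveData.mem_points (Z := ⟨2, 1, ![X 0 ^ N + X 1 ^ N - 1]⟩) (z := z)).trans ?_
  simp [sub_eq_zero]

/-- The gradient of `x^N + y^N − 1` at `z` is `(N z₀^{N−1}, N z₁^{N−1})`. [folklore] -/
theorem gradient_fermat (N : ℕ) (z : Fin 2 → ℂ) :
    (⟨2, 1, ![X 0 ^ N + X 1 ^ N - 1]⟩ : CurveData).gradient 0 z =
      ![(N : ℂ) * z 0 ^ (N - 1), (N : ℂ) * z 1 ^ (N - 1)] := by
  funext i
  simp only [CurveData.gradient, Matrix.cons_val_zero]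
  fin_cases i
  · simp [Derivation.leibniz_pow, pderiv_X_of_ne (show (1 : Fin 2) ≠ 0 by decide)]
  · simp [Derivation.leibniz_pow, pderiv_X_of_ne (show (0 : Fin 2) ≠ 1 by decide)]

/-- A LOCAL `N`-TH ROOT BRANCH: if `a^N + b^N = 1` with `b ≠ 0` (`N ≥ 1`), then
`Y(u) = b · exp(log(w(u))/N)`, `w(u) = (1 − (a+u)^N)/b^N` (`w(0) = 1`), is continuous at `u = 0` with
`Y(0) = b` and satisfies `(a+u)^N + Y(u)^N = 1` for all small real `u`. [folklore] -/
theorem exists_root_branch {N : ℕ} (hN : 1 ≤ N) {a b : ℂ} (h : a ^ N + b ^ N = 1) (hb : b ≠ 0) :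
    ∃ Y : ℝ → ℂ, Tendsto Y (𝓝 0) (𝓝 b) ∧
      ∀ᶠ u : ℝ in 𝓝[≠] 0, (a + (u : ℂ)) ^ N + Y u ^ N = 1 := by
  have hN0 : N ≠ 0 := by omega
  have hbN : b ^ N ≠ 0 := pow_ne_zero N hb
  obtain ⟨w, hw⟩ : ∃ w : ℝ → ℂ, w = fun u : ℝ => (1 - (a + (u : ℂ)) ^ N) / b ^ N := ⟨_, rfl⟩
  have hwc : Continuous w := by rw [hw]; fun_prop
  have hw0 : w 0 = 1 := by
    have h1 : 1 - a ^ N = b ^ N := by rw [← h]; ring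
    rw [hw]
    simp only [Complex.ofReal_zero, add_zero]
    rw [h1, div_self hbN]
  obtain ⟨Y, hY⟩ : ∃ Y : ℝ → ℂ, Y = fun u : ℝ => b * Complex.exp (Complex.log (w u) / N) :=
    ⟨_, rfl⟩
  have hYc : ContinuousAt Y 0 := by
    rw [hY]
    refine continuousAt_const.mul (ContinuousAt.cexp (ContinuousAt.div_const ?_ _))
    exact hwc.continuousAt.clog (by rw [hw0]; exact Complex.one_mem_slitPlane)
  have hY0 : Y 0 = b := by rw [hY]; simp [hw0]
  have hYpow : ∀ u, w u ≠ 0 → Y u ^ N = 1 - (a + (u : ℂ)) ^ N := fun u hu => by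
    have hNc : (N : ℂ) ≠ 0 := Nat.cast_ne_zero.2 hN0
    rw [hY]
    simp only
    rw [mul_pow, ← Complex.exp_nat_mul, mul_div_cancel₀ _ hNc, Complex.exp_log hu, hw]
    simp only
    rw [mul_div_cancel₀ _ hbN]
  refine ⟨Y, ?_, ?_⟩
  · have h1 := hYc.tendsto
    rwa [hY0] at h1
  · have h1 : ∀ᶠ u : ℝ in 𝓝[≠] 0, w u ≠ 0 :=
      (hwc.continuousAt.eventually_ne (by rw [hw0]; exact one_ne_zero)).filter_mono
        nhdsWithin_le_nhds
    filter_upwards [h1] with u hu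
    rw [hYpow u hu]
    ring

/-- **`F_N = {x^N + y^N = 1} ⊂ 𝔸²` is a smooth affine curve over `ℚ̄`** for `N ≥ 1`: the equation is
over `ℚ`, the gradient `(N x^{N−1}, N y^{N−1})` cannot vanish on the curve (else `x^N = y^N = 0`),
and no point is isolated (local `N`-th root branch through every point, in `x` or in `y`).
[cite: HuberWustholz2022, §3.3.1] -/
theorem isSmoothAffineCurve_fermat {N : ℕ} (hN : 1 ≤ N) :
    (⟨2, 1, ![X 0 ^ N + X 1 ^ N - 1]⟩ : CurveData).IsSmoothAffineCurve where
  algebraic j := by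
    fin_cases j
    simpa using (((hasAlgCoeffs_X (n := 2) 0).pow N).add ((hasAlgCoeffs_X 1).pow N)).sub
      hasAlgCoeffs_one
  rank_eq z hz := by
    rw [mem_points_fermat_iff] at hz
    have hrange : (Set.range fun j : Fin 1 =>
        (⟨2, 1, ![X 0 ^ N + X 1 ^ N - 1]⟩ : CurveData).gradient j z) =
        {![(N : ℂ) * z 0 ^ (N - 1), (N : ℂ) * z 1 ^ (N - 1)]} := by
      rw [Set.range_unique]
      simp only [Fin.default_eq_zero, gradient_fermat]
    rw [hrange]
    have hv : (![(N : ℂ) * z 0 ^ (N - 1), (N : ℂ) * z 1 ^ (N - 1)] : Fin 2 → ℂ) ≠ 0 := by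
      intro h0
      have hN0 : (N : ℂ) ≠ 0 := Nat.cast_ne_zero.2 (by omega)
      have h1 := congrFun h0 0
      have h2 := congrFun h0 1
      simp only [Matrix.cons_val_zero, Matrix.cons_val_one, Pi.zero_apply, mul_eq_zero, hN0,
        false_or] at h1 h2
      have hN1 : N = N - 1 + 1 := (Nat.sub_add_cancel hN).symm
      rw [hN1, pow_succ, pow_succ, h1, h2, zero_mul, zero_mul, add_zero] at hz
      exact zero_ne_one hz
    exact finrank_span_singleton hv
  not_isolated z hz := by
    rw [mem_points_fermat_iff] at hz
    have h2 : ∀ᶠ u : ℝ in 𝓝[≠] 0, u ≠ 0 := eventually_nhdsWithin_of_forall fun u hu => hu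
    by_cases hy : z 1 = 0
    · -- `y₀ = 0`: then `x₀ ≠ 0`; the branch `u ↦ (Y(u), y₀ + u)`
      have hx : z 0 ≠ 0 := by
        intro h0
        rw [h0, hy, zero_pow (by omega : N ≠ 0), add_zero] at hz
        exact zero_ne_one hz
      have hz' : z 1 ^ N + z 0 ^ N = 1 := by rw [add_comm]; exact hz
      obtain ⟨Y, hYt, hYev⟩ := exists_root_branch hN hz' hx
      obtain ⟨c, hc⟩ : ∃ c : ℝ → (Fin 2 → ℂ), c = fun u : ℝ => ![Y u, z 1 + (u : ℂ)] := ⟨_, rfl⟩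
      have hcc : Tendsto c (𝓝 0) (𝓝 z) := by
        rw [hc, tendsto_pi_nhds]
        intro k
        fin_cases k
        · simpa using hYt
        · have hk : Continuous fun u : ℝ => z 1 + (u : ℂ) := by fun_prop
          simpa using hk.tendsto 0
      refine mem_closure_of_tendsto (b := 𝓝[≠] (0 : ℝ)) (f := c)
        (hcc.mono_left nhdsWithin_le_nhds) ?_
      filter_upwards [hYev, h2] with u hu1 hu2
      refine ⟨(mem_points_fermat_iff N _).2 ?_, ?_⟩
      · simp only [hc, Matrix.cons_val_one, Matrix.cons_val_zero]
        rw [add_comm]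
        exact hu1
      · intro h0
        have h1 := congrFun h0 1
        simp only [hc, Matrix.cons_val_one, Matrix.cons_val_zero, add_eq_left,
          Complex.ofReal_eq_zero] at h1
        exact hu2 h1
    · -- `y₀ ≠ 0`: the branch `u ↦ (x₀ + u, Y(u))`
      obtain ⟨Y, hYt, hYev⟩ := exists_root_branch hN hz hy
      obtain ⟨c, hc⟩ : ∃ c : ℝ → (Fin 2 → ℂ), c = fun u : ℝ => ![z 0 + (u : ℂ), Y u] := ⟨_, rfl⟩
      have hcc : Tendsto c (𝓝 0) (𝓝 z) := by
        rw [hc, tendsto_pi_nhds]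
        intro k
        fin_cases k
        · have hk : Continuous fun u : ℝ => z 0 + (u : ℂ) := by fun_prop
          simpa using hk.tendsto 0
        · simpa using hYt
      refine mem_closure_of_tendsto (b := 𝓝[≠] (0 : ℝ)) (f := c)
        (hcc.mono_left nhdsWithin_le_nhds) ?_
      filter_upwards [hYev, h2] with u hu1 hu2
      refine ⟨(mem_points_fermat_iff N _).2 ?_, ?_⟩
      · simp only [hc, Matrix.cons_val_one, Matrix.cons_val_zero]
        exact hu1
      · intro h0
        have h1 := congrFun h0 0
        simp only [hc, Matrix.cons_val_zero, add_eq_left, Complex.ofReal_eq_zero] at h1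
        exact hu2 h1

/-! ## The radial arc `γ_N(t) = Q(t)^{−1/N} · (1 − t, t)`, `Q(t) = (1−t)^N + t^N` -/

/-- `Q(t) = (1−t)^N + t^N > 0` for every real `t` (`N ≥ 1`): for `t < 1/2`, `|t| < 1 − t`, so
`|t|^N < (1−t)^N` and `t^N ≥ −|t|^N`; `t > 1/2` by the symmetry `t ↦ 1 − t`. [folklore] -/
theorem fermatQ_pos {N : ℕ} (hN : 1 ≤ N) (t : ℝ) : 0 < (1 - t) ^ N + t ^ N := by
  have key : ∀ s : ℝ, s < 1 / 2 → 0 < (1 - s) ^ N + s ^ N := fun s hs => by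
    have h1 : |s| < 1 - s := by
      rcases le_or_gt 0 s with h | h
      · rw [abs_of_nonneg h]; linarith
      · rw [abs_of_neg h]; linarith
    have h2 : |s| ^ N < (1 - s) ^ N := pow_lt_pow_left₀ h1 (abs_nonneg s) (by omega)
    have h3 : -|s| ^ N ≤ s ^ N := by rw [← abs_pow]; exact neg_abs_le _
    linarith
  rcases lt_trichotomy t (1 / 2) with h | rfl | h
  · exact key t h
  · exact add_pos (pow_pos (by norm_num) N) (pow_pos (by norm_num) N)
  · have h' := key (1 - t) (by linarith)
    rw [sub_sub_cancel] at h'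
    linarith

/-- ON THE CURVE: `((1−t) λ)^N + (t λ)^N = 1` for `λ = Q(t)^{−1/N}` (`λ^N = Q^{−1}`). [folklore] -/
theorem fermatArc_pow_add_pow {N : ℕ} (hN : 1 ≤ N) (t : ℝ) :
    ((1 - t) * ((1 - t) ^ N + t ^ N) ^ (-(1:ℝ) / N)) ^ N +
      (t * ((1 - t) ^ N + t ^ N) ^ (-(1:ℝ) / N)) ^ N = 1 := by
  have hQ := fermatQ_pos hN t
  have hN0 : (N : ℝ) ≠ 0 := Nat.cast_ne_zero.2 (by omega)
  have hL : (((1 - t) ^ N + t ^ N) ^ (-(1:ℝ) / N)) ^ N = ((1 - t) ^ N + t ^ N)⁻¹ := by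
    rw [← Real.rpow_natCast, ← Real.rpow_mul hQ.le, div_mul_cancel₀ _ hN0, Real.rpow_neg_one]
  rw [mul_pow, mul_pow, hL, ← add_mul, mul_inv_cancel₀ hQ.ne']

/-- THE RADIAL ARC as a `CurvePath` on `F_N` (`N ≥ 1`): `toFun` is the formula
`t ↦ ((1−t) Q^{−1/N}, t Q^{−1/N})` for all real `t`; it is `C¹` (indeed smooth, `Q > 0`), lies on
`F_N`, has the algebraic end points `(1,0)`, `(0,1)`, and its real and imaginary parts form a
`ℚ`-semialgebraic map on `{z | z 0 ∈ [0,1]}` (`Q^{−1/N}` is a rational power of a positive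
polynomial). [cite: HuberWustholz2022, §3.3.1] -/
theorem exists_fermatPath {N : ℕ} (hN : 1 ≤ N) :
    ∃ γ : CurvePath (⟨2, 1, ![X 0 ^ N + X 1 ^ N - 1]⟩ : CurveData),
      (∀ t : ℝ, γ.toFun t = ![(((1 - t) * ((1 - t) ^ N + t ^ N) ^ (-(1:ℝ) / N) : ℝ) : ℂ),
        ((t * ((1 - t) ^ N + t ^ N) ^ (-(1:ℝ) / N) : ℝ) : ℂ)]) ∧
      IsSemialgebraicMapOn ℚ {z : Fin 1 → ℝ | z 0 ∈ Set.Icc (0 : ℝ) 1}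
        (fun z => Fin.append (fun i => (γ.toFun (z 0) i).re) (fun i => (γ.toFun (z 0) i).im)) := by
  have hN0 : N ≠ 0 := by omega
  -- the two real coordinates
  obtain ⟨a, ha⟩ : ∃ a : ℝ → ℝ, a = fun t => (1 - t) * ((1 - t) ^ N + t ^ N) ^ (-(1:ℝ) / N) :=
    ⟨_, rfl⟩
  obtain ⟨b, hb⟩ : ∃ b : ℝ → ℝ, b = fun t => t * ((1 - t) ^ N + t ^ N) ^ (-(1:ℝ) / N) :=
    ⟨_, rfl⟩
  have hLcd : ContDiff ℝ 1 (fun t : ℝ => ((1 - t) ^ N + t ^ N) ^ (-(1:ℝ) / N)) := by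
    have hQcd : ContDiff ℝ 1 (fun t : ℝ => (1 - t) ^ N + t ^ N) := by fun_prop
    exact hQcd.rpow_const_of_ne fun t => (fermatQ_pos hN t).ne'
  have hacd : ContDiff ℝ 1 a := by rw [ha]; exact (contDiff_const.sub contDiff_id).mul hLcd
  have hbcd : ContDiff ℝ 1 b := by rw [hb]; exact contDiff_id.mul hLcd
  have hab : ∀ t, a t ^ N + b t ^ N = 1 := fun t => by
    rw [ha, hb]
    exact fermatArc_pow_add_pow hN t
  have ha0 : a 0 = 1 := by rw [ha]; simp [hN0]
  have hb0 : b 0 = 0 := by rw [hb]; simp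
  have ha1 : a 1 = 0 := by rw [ha]; simp
  have hb1 : b 1 = 1 := by rw [hb]; simp [hN0]
  let γ : CurvePath (⟨2, 1, ![X 0 ^ N + X 1 ^ N - 1]⟩ : CurveData) :=
    { toFun := fun t => ![((a t : ℝ) : ℂ), ((b t : ℝ) : ℂ)]
      contDiffOn := by
        refine contDiffOn_pi.2 fun i => ?_
        fin_cases i
        · exact (Complex.ofRealCLM.contDiff.comp hacd).contDiffOn
        · exact (Complex.ofRealCLM.contDiff.comp hbcd).contDiffOn
      mem_points := fun t _ => by
        rw [mem_points_fermat_iff]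
        simp only [Matrix.cons_val_one, Matrix.cons_val_zero]
        exact_mod_cast hab t
      algebraic_zero := fun i => by
        fin_cases i
        · show IsAlgebraic ℚ ((a 0 : ℝ) : ℂ)
          rw [ha0]
          simpa using isAlgebraic_one
        · show IsAlgebraic ℚ ((b 0 : ℝ) : ℂ)
          rw [hb0]
          simpa using isAlgebraic_zero
      algebraic_one := fun i => by
        fin_cases i
        · show IsAlgebraic ℚ ((a 1 : ℝ) : ℂ)
          rw [ha1]
          simpa using isAlgebraic_zero
        · show IsAlgebraic ℚ ((b 1 : ℝ) : ℂ)
          rw [hb1]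
          simpa using isAlgebraic_one }
  have hγ : γ.toFun = fun t : ℝ => (![((a t : ℝ) : ℂ), ((b t : ℝ) : ℂ)] : Fin 2 → ℂ) := rfl
  refine ⟨γ, fun t => ?_, ?_⟩
  · rw [hγ]
    simp only [ha, hb]
  -- the realified path is `ℚ`-semialgebraic on `[0, 1]`
  have hdom : IsSemialgebraic ℚ {z : Fin 1 → ℝ | z 0 ∈ Icc (0 : ℝ) 1} :=
    Summit.KontsevichZagierPeriods.SymplecticScissors.RealOnePeriodRelations.Realises.isSemialgebraic_IccDom
  have hz : IsSemialgebraicFunOn ℚ {z : Fin 1 → ℝ | z 0 ∈ Icc (0 : ℝ) 1} (fun z => z 0) :=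
    (isSemialgebraicFunOn_aeval hdom (X 0)).congr fun z _ => by simp
  have h1z : IsSemialgebraicFunOn ℚ {z : Fin 1 → ℝ | z 0 ∈ Icc (0 : ℝ) 1} (fun z => 1 - z 0) :=
    (isSemialgebraicFunOn_aeval hdom (1 - X 0)).congr fun z _ => by simp
  have hQ : IsSemialgebraicFunOn ℚ {z : Fin 1 → ℝ | z 0 ∈ Icc (0 : ℝ) 1}
      (fun z => (1 - z 0) ^ N + (z 0) ^ N) := (h1z.fun_pow N).fun_add (hz.fun_pow N)
  have hL : IsSemialgebraicFunOn ℚ {z : Fin 1 → ℝ | z 0 ∈ Icc (0 : ℝ) 1}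
      (fun z => ((1 - z 0) ^ N + (z 0) ^ N) ^ (-(1:ℝ) / N)) :=
    (hQ.rpow_ratCast hdom (fun z _ => fermatQ_pos hN (z 0)) (-1 / N)).congr fun z _ => by
      rw [show (((-1 / N : ℚ) : ℚ) : ℝ) = -(1:ℝ) / N by push_cast; ring]
  have hA : IsSemialgebraicFunOn ℚ {z : Fin 1 → ℝ | z 0 ∈ Icc (0 : ℝ) 1} (fun z => a (z 0)) :=
    (h1z.fun_mul hL).congr fun z _ => by rw [ha]
  have hB : IsSemialgebraicFunOn ℚ {z : Fin 1 → ℝ | z 0 ∈ Icc (0 : ℝ) 1} (fun z => b (z 0)) :=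
    (hz.fun_mul hL).congr fun z _ => by rw [hb]
  show IsSemialgebraicMapOn ℚ {z : Fin 1 → ℝ | z 0 ∈ Icc (0 : ℝ) 1}
    (fun z => Fin.append (m := 2) (n := 2) (fun i => (γ.toFun (z 0) i).re)
      (fun i => (γ.toFun (z 0) i).im))
  refine IsSemialgebraicMapOn.of_forall hdom fun j => ?_
  refine Fin.addCases (fun i => ?_) (fun i => ?_) j
  · simp only [Fin.append_left, hγ]
    fin_cases i
    · exact hA.congr fun z _ => by simp
    · exact hB.congr fun z _ => by simp
  · simp only [Fin.append_right, hγ]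
    fin_cases i <;> exact (isSemialgebraicFunOn_natCast hdom 0).congr fun z _ => by simp

/-- STUB `stub_fermatSymbolData` (symbol data): for `N ≥ 1` the affine Fermat curve `x^N + y^N = 1`
is a smooth affine curve over `ℚ̄` (gradient `(N x^{N-1}, N y^{N-1}) ≠ 0` on the curve; no isolated
points by a local `N`-th root), and the radial arc `γ_N(t) = ((1−t)·Q(t)^{−1/N}, t·Q(t)^{−1/N})`,
`Q(t) = (1−t)^N + t^N > 0`, is a `C¹` path on it with the algebraic end points `(1,0)`, `(0,1)`, whose
real and imaginary parts form a `ℚ`-semialgebraic map on `[0,1]`.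
[cite: Gross1978, §1] [cite: HuberWustholz2022, §3.3.1] -/
theorem stub_fermatSymbolData : ∀ N : ℕ, 1 ≤ N →
    (⟨2, 1, ![X 0 ^ N + X 1 ^ N - 1]⟩ : CurveData).IsSmoothAffineCurve ∧
    ∃ γ : CurvePath (⟨2, 1, ![X 0 ^ N + X 1 ^ N - 1]⟩ : CurveData),
      (∀ t : ℝ, γ.toFun t = ![(((1 - t) * ((1 - t) ^ N + t ^ N) ^ (-(1:ℝ) / N) : ℝ) : ℂ),
        ((t * ((1 - t) ^ N + t ^ N) ^ (-(1:ℝ) / N) : ℝ) : ℂ)]) ∧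
      IsSemialgebraicMapOn ℚ {z : Fin 1 → ℝ | z 0 ∈ Set.Icc (0 : ℝ) 1}
        (fun z => Fin.append (fun i => (γ.toFun (z 0) i).re) (fun i => (γ.toFun (z 0) i).im)) :=
  fun _ hN => ⟨isSmoothAffineCurve_fermat hN, exists_fermatPath hN⟩

end Summit.KontsevichZagierPeriods.FermatIsogeny.BetaLinearSector

end
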